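import Summits.QuantumFields.YangMills.Theorems.UnitScaleTiltProp8EulerLagrangeLie
import Literature.MathematicalPhysics.QuantumFieldTheory.Balaban1983to89.B14Eq16FaddeevPopov
import HarnessLib

/-!
# Route `UnitScaleTilt`, crux K1 «MinimiserStabilityRegPr» (stmt-QuantumFields-19200), stub `stub_prop8` (V2) — sub-lemma V2-EL, part 7e:
# **CURRENT CONSERVATION**: the first variation of the `SU(2)` Wilson action vanishes along every gauge direction, at EVERY configuration
# (`lin_gaugeDir_eq_zero`)

Cell `ym3-torus` ∕ fleet seat `ym-ust-19200-p2` g4.  The Euler–Lagrange equations of parts 5–7 (`Lin_{U₀}(ξ) = 0` along the tangent space of the (0.4)-fibre)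
are complemented by the identities that hold at every `U₀`, critical or not: for every `𝔰𝔲(2)`-valued site function `λ`, the infinitesimal gauge transformation
`ξ_λ(b) = λ(b₋) − U₀(b)λ(b₊)U₀(b)^*` satisfies `Lin_{U₀}(ξ_λ) = 0` — the lattice Noether identity `D^*_{U₀}J_{U₀} = 0` for the current `J_{U₀} = ∂A/∂U` (the
compatibility of the Euler–Lagrange system with the Landau gauge, [Balaban1985Variational] (111) vs (143), p. 300).  PROOF: the Wilson action is constant on
the gauge orbit of `U₀` (`B14Eq16FaddeevPopov.wilsonAction4_gaugeAct'`), so `U₀` minimises it there; the curve `t ↦ U₀^{exp(tλ)}` lies on the orbit and is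
bondwise differentiable; part 3's `lin_eq_zero_of_isMinOn_of_hasDerivAt`.  Sorry-free, no definition. [folklore]
References: T. Bałaban, CMP 102 (1985) 277–309 [Balaban1985Variational] ((127) p.297, (143) p.300); CMP 98 (1985) 17–51 [Balaban1985Averaging] ((12) p.19).
-/

noncomputable section

open scoped BigOperators Matrix.Norms.L2Operator Matrix Topology
open Filter Function NormedSpace

namespace Summit.QuantumFields.YangMills.Theorems.Prop8Criticality

open Literature.MathematicalPhysics.QuantumFieldTheory.Balaban1983to89
open T4Continuum
open Literature.LinearAlgebra.Matrix (exp_mem_specialUnitaryGroup_of_mem_skewAdjoint)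

variable {P : Params} {j : ℕ}

/-- The exponential of a skew-Hermitian trace-zero `2×2` matrix, scaled by a real parameter, is special unitary. [folklore] -/
theorem exp_smul_mem_su2 {X : Matrix (Fin 2) (Fin 2) ℂ} (hX : X ∈ skewAdjoint (Matrix (Fin 2) (Fin 2) ℂ)) (htr : X.trace = 0) (t : ℝ) :
    exp (t • X) ∈ Matrix.specialUnitaryGroup (Fin 2) ℂ :=
  exp_mem_specialUnitaryGroup_of_mem_skewAdjoint (skewAdjoint.smul_mem t hX) (by rw [Matrix.trace_smul, htr, smul_zero])

/-- **CURRENT CONSERVATION ∕ THE LATTICE NOETHER IDENTITY FOR THE `SU(2)` WILSON ACTION.**  For EVERY configuration `U₀` (any torus of the setup, any level)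
and every site function `λ` with values in `𝔰𝔲(2)` (skew-Hermitian, trace zero), the infinitesimal gauge transformation `ξ_λ(b) = λ(b₋) − U₀(b)λ(b₊)U₀(b)^*`
is a direction of vanishing first variation: `Lin_{U₀}(ξ_λ) = 0`. [cite: Balaban1985Averaging, (12) p.19; Balaban1985Variational, (127) p.297] -/
theorem lin_gaugeDir_eq_zero (U₀ : GaugeField P j (Matrix.specialUnitaryGroup (Fin 2) ℂ))
    (lam : Site P j → Matrix (Fin 2) (Fin 2) ℂ)
    (hlam : ∀ x, lam x ∈ skewAdjoint (Matrix (Fin 2) (Fin 2) ℂ)) (htr : ∀ x, (lam x).trace = 0) :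
    ∑ p : Plaq P j, (1 / 2) * ((((((GaugeField.plaqHol U₀ p : Matrix.specialUnitaryGroup (Fin 2) ℂ) : Matrix (Fin 2) (Fin 2) ℂ)) - 1)ᴴ
          * (((lam p.src - (U₀ ⟨p.src, p.μ⟩ : Matrix (Fin 2) (Fin 2) ℂ) * lam (p.src.shift p.μ) * star (U₀ ⟨p.src, p.μ⟩ : Matrix (Fin 2) (Fin 2) ℂ))
              + (U₀ ⟨p.src, p.μ⟩ : Matrix (Fin 2) (Fin 2) ℂ)
                  * (lam (p.src.shift p.μ) - (U₀ ⟨p.src.shift p.μ, p.ν⟩ : Matrix (Fin 2) (Fin 2) ℂ) * lam ((p.src.shift p.μ).shift p.ν)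
                      * star (U₀ ⟨p.src.shift p.μ, p.ν⟩ : Matrix (Fin 2) (Fin 2) ℂ))
                  * star (U₀ ⟨p.src, p.μ⟩ : Matrix (Fin 2) (Fin 2) ℂ)
              - ((U₀ ⟨p.src, p.μ⟩ * U₀ ⟨p.src.shift p.μ, p.ν⟩ * (U₀ ⟨p.src.shift p.ν, p.μ⟩)⁻¹ : Matrix.specialUnitaryGroup (Fin 2) ℂ) : Matrix (Fin 2) (Fin 2) ℂ)
                  * (lam (p.src.shift p.ν) - (U₀ ⟨p.src.shift p.ν, p.μ⟩ : Matrix (Fin 2) (Fin 2) ℂ) * lam ((p.src.shift p.ν).shift p.μ)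
                      * star (U₀ ⟨p.src.shift p.ν, p.μ⟩ : Matrix (Fin 2) (Fin 2) ℂ))
                  * star ((U₀ ⟨p.src, p.μ⟩ * U₀ ⟨p.src.shift p.μ, p.ν⟩ * (U₀ ⟨p.src.shift p.ν, p.μ⟩)⁻¹ : Matrix.specialUnitaryGroup (Fin 2) ℂ) : Matrix (Fin 2) (Fin 2) ℂ)
              - ((GaugeField.plaqHol U₀ p : Matrix.specialUnitaryGroup (Fin 2) ℂ) : Matrix (Fin 2) (Fin 2) ℂ)
                  * (lam p.src - (U₀ ⟨p.src, p.ν⟩ : Matrix (Fin 2) (Fin 2) ℂ) * lam (p.src.shift p.ν) * star (U₀ ⟨p.src, p.ν⟩ : Matrix (Fin 2) (Fin 2) ℂ))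
                  * star ((GaugeField.plaqHol U₀ p : Matrix.specialUnitaryGroup (Fin 2) ℂ) : Matrix (Fin 2) (Fin 2) ℂ))
            * ((GaugeField.plaqHol U₀ p : Matrix.specialUnitaryGroup (Fin 2) ℂ) : Matrix (Fin 2) (Fin 2) ℂ))).trace).re = 0 := by
  -- the gauge direction as a bond field
  set ξ : PBond P j → Matrix (Fin 2) (Fin 2) ℂ := fun b =>
    lam b.src - (U₀ b : Matrix (Fin 2) (Fin 2) ℂ) * lam b.tgt * star (U₀ b : Matrix (Fin 2) (Fin 2) ℂ) with hξ
  -- the orbit and the trivial minimality on it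
  set S : Set (GaugeField P j (Matrix.specialUnitaryGroup (Fin 2) ℂ)) :=
    Set.range fun u : GaugeTransf P j (Matrix.specialUnitaryGroup (Fin 2) ℂ) => GaugeField.gaugeAct u U₀ with hS
  have hmin : IsMinOn (fun W : GaugeField P j (Matrix.specialUnitaryGroup (Fin 2) ℂ) => wilsonAction4 W) S U₀ := by
    intro W hW
    obtain ⟨u, rfl⟩ := hW
    show wilsonAction4 U₀ ≤ wilsonAction4 (GaugeField.gaugeAct u U₀)
    rw [B14Eq16FaddeevPopov.wilsonAction4_gaugeAct']
  -- the one-parameter gauge curve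
  set u : ℝ → GaugeTransf P j (Matrix.specialUnitaryGroup (Fin 2) ℂ) := fun t x => ⟨exp (t • lam x), exp_smul_mem_su2 (hlam x) (htr x) t⟩ with hu
  set γ : ℝ → GaugeField P j (Matrix.specialUnitaryGroup (Fin 2) ℂ) := fun t => GaugeField.gaugeAct (u t) U₀ with hγ
  have hγS : ∀ᶠ t in 𝓝 (0 : ℝ), γ t ∈ S := Filter.Eventually.of_forall fun t => ⟨u t, rfl⟩
  have hu0 : ∀ x, u 0 x = 1 := fun x => by
    apply Subtype.ext
    show exp ((0 : ℝ) • lam x) = 1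
    rw [zero_smul, exp_zero]
  have hγ0 : γ 0 = U₀ := by
    funext b
    show u 0 b.src * U₀ b * (u 0 b.tgt)⁻¹ = U₀ b
    rw [hu0, hu0, one_mul, inv_one, mul_one]
  have hcoe : ∀ t b, ((γ t b : Matrix.specialUnitaryGroup (Fin 2) ℂ) : Matrix (Fin 2) (Fin 2) ℂ) =
      exp (t • lam b.src) * (U₀ b : Matrix (Fin 2) (Fin 2) ℂ) * star (exp (t • lam b.tgt)) := fun t b => rfl
  -- bondwise derivatives
  have hξd : ∀ b : PBond P j,
      HasDerivAt (fun t : ℝ => ((γ t b : Matrix.specialUnitaryGroup (Fin 2) ℂ) : Matrix (Fin 2) (Fin 2) ℂ) * star (U₀ b : Matrix (Fin 2) (Fin 2) ℂ)) (ξ b) 0 := by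
    intro b
    have h1 : HasDerivAt (fun t : ℝ => exp (t • lam b.src)) (lam b.src) 0 := by
      have := hasDerivAt_exp_smul_const' (𝕂 := ℝ) (lam b.src) (0 : ℝ)
      simp only [zero_smul, exp_zero, mul_one] at this
      exact this
    have h2 : HasDerivAt (fun t : ℝ => star (exp (t • lam b.tgt))) (star (lam b.tgt)) 0 := by
      have := hasDerivAt_exp_smul_const' (𝕂 := ℝ) (lam b.tgt) (0 : ℝ)
      simp only [zero_smul, exp_zero, mul_one] at this
      exact this.star
    have h3 := ((h1.mul_const ((U₀ b : Matrix.specialUnitaryGroup (Fin 2) ℂ) : Matrix (Fin 2) (Fin 2) ℂ)).mul h2).mul_const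
      (star ((U₀ b : Matrix.specialUnitaryGroup (Fin 2) ℂ) : Matrix (Fin 2) (Fin 2) ℂ))
    simp only [zero_smul, exp_zero, star_one, mul_one, one_mul] at h3
    have hfun : (fun t : ℝ => ((γ t b : Matrix.specialUnitaryGroup (Fin 2) ℂ) : Matrix (Fin 2) (Fin 2) ℂ) * star (U₀ b : Matrix (Fin 2) (Fin 2) ℂ)) =
        fun t : ℝ => exp (t • lam b.src) * (U₀ b : Matrix (Fin 2) (Fin 2) ℂ) * star (exp (t • lam b.tgt)) * star (U₀ b : Matrix (Fin 2) (Fin 2) ℂ) := by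
      funext t; rw [hcoe]
    rw [hfun]
    refine h3.congr_deriv ?_
    have hUU : ((U₀ b : Matrix.specialUnitaryGroup (Fin 2) ℂ) : Matrix (Fin 2) (Fin 2) ℂ) * star (U₀ b : Matrix (Fin 2) (Fin 2) ℂ) = 1 :=
      Matrix.mem_unitaryGroup_iff.mp (U₀ b).2.1
    have hstar : star (lam b.tgt) = -lam b.tgt := (hlam b.tgt)
    rw [hξ, add_mul, mul_assoc (lam b.src), hUU, mul_one, hstar]
    simp only [PBond.tgt]
    noncomm_ring
  have main := lin_eq_zero_of_isMinOn_of_hasDerivAt hmin γ hγS hγ0 ξ hξd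
  simpa only [hξ, PBond.tgt] using main

end Summit.QuantumFields.YangMills.Theorems.Prop8Criticality

end
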